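import Literature.NumberTheory.Automorphic.ArchInnerFormChartMeasures            -- ★ (T-MEAS-G′) LH3-p02 (g2): `chartTorusG ∕ chartQuotientMeasureG ∕ chartOrbG`, `chartTorusG_eq_centralizer`, `forall_mem_chartTorusG_comm`
import Literature.NumberTheory.Rogawski1990.ArchInnerFormChartOrbIntegrable        -- ★ p850485 (J-DESC) D4b-3 ED. 2 F0P3a-p08 (g22): `uniformlyProper_gprimeTorus_regG` (RegG-box, modulo `Z(gprimeTorus c₀)`) over ★ SPLIT-DOCK p850470
import Literature.MeasureTheory.Group.QuotientOrbitalIntegralProperSmooth         -- ★ (G) LH3-p01 (g3): `contDiffOn_integral_descConj_of_uniformlyProper` (Hörmander engine)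
import Literature.NumberTheory.Rogawski1990.ArchSmoothAmbientLift                 -- ★ `ArchSmooth.exists_contDiff` (ambient smooth `Θ` on `M₃(L ⊗ ℝ)`)
import Literature.NumberTheory.Automorphic.ArchTorusOrbitalFubiniSmooth           -- ★ `coe_archPiEquivCM_symm_apply` (the matrix of `archPiEquivCM⁻¹ u`)
import Literature.NumberTheory.Rogawski1990.ArchHCOrbitalFamilyG                  -- ★ (D2′) LH3-p02 (g2): `orbFamG`, `orbFamG_apply` (+ ★ `archRG`, `archRG_ne_zero_of_mem_regG`)
import Literature.NumberTheory.Rogawski1990.ArchHCOrbitalFamilyGExt               -- ★ (G′-EXT) LH3-p02 (g2): `orbFamGExt`, `orbFamGExt_eqOn_regG` (ED. 2 §6)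
import Literature.MeasureTheory.Group.QuotientOrbitalIntegralProperContinuity     -- ★ (W1-cont-Π) FILE 1 LH2-p04 (g3): `continuousOn_integral_descConj_of_uniformlyProper` (ED. 2 §5)
import HarnessLib

/-!
# The chart orbital functionals `chartOrbG` of the inner form `G′_∞` and the ordinary orbital family `orbFamG` are `C^∞` on the regular set `RegG S′` of every chart
# («(I₂-RegG-G′)»: Harish-Chandra smoothness of ordinary orbital integrals away from the walls; Rogawski 1990 §8.2–8.3, Shelstad 1979 §4, Bouaziz 1994 §3.2)

Topic `NumberTheory/Automorphic`; namespaces `Literature.NumberTheory.Automorphic.UnitaryGroup` (§1–§3), `Literature.NumberTheory.Automorphic.ArchCartan` (§4a) and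
`Literature.NumberTheory.Rogawski1990` (§4b).  THEOREMS ONLY (no `def`, no instance, no notation, no axiom, no named fact, no `sorry`).
Cell `pub/hodgecm-mathlib`, crux H413 (`stmt-HodgeConjecture-24833`), line LH3 (closer stub `stub_N9`, direct road), LETTER L1 `HcOrbitalFamiliesStatement`
(«`orbFamGExt ν′ a′ ∈ ArchHCSpaceG (slotSign α) jc′` for every `a′ ∈ C_c^∞(G′_∞)`»), clause (I₁)∕(I₂) `ArchHcSmoothOneSided` AWAY FROM THE WALLS for the GENUINE family
(LH3-plan (g3) 2026-09-02T08:17:49Z «= DEFAULT (I₂-RegG-G′) as a LETTER-L1 PAY-DOWN»; seat F0P3a-p05 (g20)).  The `G′`-side twin of ★ `ArchEndoscopicChartOrbitalSmooth`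
(`contDiffOn_chartOrbH_regS` ∕ `contDiffOn_stOrbFamH_regS`, LH3-p01 (g3)); count-neutral.

THE MATHEMATICS.  `G′_∞ = U(diag α)(L⁺ ⊗ ℝ) ≅ Π_w G′_w` over the complex places `w` of the CM field `L`; the Cartan of chart type `S′` (noncompact at `w ∈ S′`) is
`T_{S′} = chartTorusG α S′` with chart `c ↦ gprimeTorus α S′ c` (the boost `boostStd` re-indexed to the lines of the form at a split place `w ∈ S′`, the unit diagonal
`diag(e^{iθ})` at a compact-chart place).  For `a′ ∈ C_c^∞(G′_∞)` (★ `ArchSmooth`, read as `a′ = Θ ∘ (↑↑·)` with `Θ` smooth on `M₃(L ⊗ ℝ)`, ★ `ArchSmooth.exists_contDiff`)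
the chart orbital functional `chartOrbG ν′ S′ a′ c = dt′(B′) · ∫_{G′_∞ ⧸ T_{S′}} a′(y · gprimeTorus α S′ c · y⁻¹) d(ν′∕dt′)` is `C^∞` on the regular set `RegG S′`:
* §1 the chart is smooth in matrix currency, `c ↦ ↑↑(gprimeTorus α S′ c) ∈ M₃(L ⊗ ℝ)` (entries `e^{iθ} cosh x`, `e^{iθ} r^{±1} sinh x`, `e^{iφ}`; ★ `coe_archPiEquivCM_symm_apply`);
* §2 (HYP) «uniformly proper modulo `T_{S′}` on `RegG S′`» — Harish-Chandra's compactness lemma for the atlas, a re-reading of ★ (J-DESC)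
  `Rogawski1990.uniformlyProper_gprimeTorus_regG` (F0P3a-p08 (g22), over ★ SPLIT-DOCK `uniformlyProper_gprimeBlock_split_of_ne_zero` and ★ (W1-cont-Π)) through
  ★ `chartTorusG_eq_centralizer` (`Z(gprimeTorus c₀) = T_{S′}` at a regular `c₀`);
* §3 the integrand FACTORS SMOOTHLY through the `T_{S′}`-invariant continuous datum `p(y) = Ad(↑↑y) ∘ π_{S′}`, `π_{S′}` a linear projection of `M₃(L ⊗ ℝ)` onto the
  commutant of `↑↑T_{S′}` — `a′(y · γ′(c) · y⁻¹) = Θ(p(y)(↑↑γ′(c)))` since `γ′(c) = gprimeTorus α S′ c` commutes with `T_{S′}` — so the generic Hörmander engine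
  ★ `contDiffOn_integral_descConj_of_uniformlyProper` (differentiation under the quotient integral) applies on ANY open set carrying (HYP)
  (`contDiffOn_chartOrbG_of_uniformlyProper`), in particular on `RegG S′` (**`contDiffOn_chartOrbG_regG`**);
* §4 Shelstad's normaliser `archRG S′` is smooth on `RegG S′` (`|e^x − e^{−x}|`, `|e^{±x+iθ} − e^{iφ}|` off their zero sets; the compact factors are entire), hence
  the ORDINARY ORBITAL FAMILY `orbFamG ν′ a′ S′ = R′ · chartOrbG` (★ `orbFamG_apply`; zero on junk labels) is `C^∞` on `RegG S′` (**`contDiffOn_orbFamG_regG`**,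
  `contDiffOn_orbFamG_regG'`) — the regular-set part of clause (I₁)∕(I₂) of `ArchHCSpaceG` for the genuine family (on `RegG S′` the HC-extended family
  `orbFamGExt` agrees with `orbFamG`, ★ `orbFamGExt_eqOn_regG`).
HONEST LABEL: the extension ACROSS the real walls `x_w = 0` and the compact walls (the rest of (I₁)∕(I₂): `ContDiffOn … (InRegG s S′)`, bounded jets, one-sided limits)
and the jump relations (I₃) are Harish-Chandra's deeper estimates and are NOT touched here; letter L1 stays a letter.  HC_CM is proved only modulo the printed citations
(2 remaining named inputs: hLiu418 = `stmt-HodgeConjecture-24832`, h413 = `stmt-HodgeConjecture-24833`) until rung 0 closes; this file moves no row of the books.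

## References
* [Rogawski1990] J. D. Rogawski, *Automorphic Representations of Unitary Groups in Three Variables*, Ann. of Math. Stud. 123 (1990), §3.6 p. 31 (Cartans of `U(2,1)`),
  §4.3 p. 43 (`G_∞ = Π_w G_w`), §4.12 Lemma 4.12.1 p. 66 (compactness lemma), §8.2 pp. 118–122, §8.3 pp. 122–124 (smoothness of orbital integrals on the regular set).
* [Shelstad1979] D. Shelstad, *Characters and inner forms of a quasi-split group over ℝ*, Compositio Math. 39 (1979), §4 pp. 22–23 (`Ψ^T_f = R_T Φ_f`, smooth on `T_reg`).
* [Bouaziz1994IntegralesOrbitales] A. Bouaziz, *Intégrales orbitales sur les groupes de Lie réductifs*, Ann. Sci. ÉNS 27 (1994), §3.1–3.2 pp. 579–580 ((I₁)∕(I₂)).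
* [Varadarajan1989] V. S. Varadarajan, *An Introduction to Harmonic Analysis on Semisimple Lie Groups* (1989), §2.4 Thm. 8 (smoothness of `F_f` on the regular set).
* [HormanderALPDO1] L. Hörmander, *The Analysis of Linear Partial Differential Operators I* (1990), Thm. 1.1.9 (differentiation under the integral sign).
* [HarishChandra1970] Harish-Chandra (notes by G. van Dijk), *Harmonic Analysis on Reductive p-adic Groups*, LNM 162 (1970), Part I §3 Lemma 22 (compactness lemma).
* [DeitmarEchterhoff2014] A. Deitmar, S. Echterhoff, *Principles of Harmonic Analysis*, 2nd ed. (2014), Lemma 9.3.3, Thm. 1.5.3.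
* [Knapp1986] A. W. Knapp, *Representation Theory of Semisimple Groups* (1986), Ch. V §3 (the noncompact Cartan of `SU(2,1)`, the boost).
-/

set_option autoImplicit false

noncomputable section

open MeasureTheory Matrix NumberField NumberField.InfinitePlace NumberField.mixedEmbedding Set Function Topology Complex
open Literature.MeasureTheory.Group Literature.NumberTheory.Rogawski1990 Literature.NumberTheory.Automorphic.ArchCartan
open Literature.NumberTheory.Automorphic.UnitaryGroup
open scoped MatrixGroups ContDiff Classical
open scoped Matrix.Norms.Operator

/-! ## §1 The chart is smooth in matrix currency -/

namespace Literature.NumberTheory.Automorphic.UnitaryGroup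

section Chart

/-- **Every entry of the standard boost `boostStd b c` is smooth in `c`** (`e^{iθ} cosh x`, `e^{iθ} r sinh x`, `e^{iφ}`, …). [cite: Knapp1986, Ch. V §3]
[cite: Rogawski1990, §3.6 p. 31] -/
theorem contDiff_boostStd_apply (b : Fin 3 → ℝ) (i j : Fin 3) : ContDiff ℝ ∞ fun c : Fin 3 → ℝ => boostStd b c i j := by
  have h0 : ContDiff ℝ ∞ fun c : Fin 3 → ℝ => ((c 0 : ℝ) : ℂ) := ofRealCLM.contDiff.comp (contDiff_apply ℝ ℝ (0 : Fin 3))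
  have h1 : ContDiff ℝ ∞ fun c : Fin 3 → ℝ => ((c 1 : ℝ) : ℂ) := ofRealCLM.contDiff.comp (contDiff_apply ℝ ℝ (1 : Fin 3))
  have h2 : ContDiff ℝ ∞ fun c : Fin 3 → ℝ => ((c 2 : ℝ) : ℂ) := ofRealCLM.contDiff.comp (contDiff_apply ℝ ℝ (2 : Fin 3))
  have he2 : ContDiff ℝ ∞ fun c : Fin 3 → ℝ => Complex.exp ((c 2 : ℂ) * I) := Complex.contDiff_exp.comp (h2.mul contDiff_const)
  have he1 : ContDiff ℝ ∞ fun c : Fin 3 → ℝ => Complex.exp ((c 1 : ℂ) * I) := Complex.contDiff_exp.comp (h1.mul contDiff_const)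
  have hch : ContDiff ℝ ∞ fun c : Fin 3 → ℝ => ((Real.cosh (c 0) : ℝ) : ℂ) := ofRealCLM.contDiff.comp (Real.contDiff_cosh.comp (contDiff_apply ℝ ℝ (0 : Fin 3)))
  have hsh : ContDiff ℝ ∞ fun c : Fin 3 → ℝ => ((Real.sinh (c 0) : ℝ) : ℂ) := ofRealCLM.contDiff.comp (Real.contDiff_sinh.comp (contDiff_apply ℝ ℝ (0 : Fin 3)))
  fin_cases i <;> fin_cases j
  · simpa [boostStd] using he2.mul hch
  · simpa [boostStd] using (contDiff_const : ContDiff ℝ ∞ fun _ : Fin 3 → ℝ => (0 : ℂ))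
  · simpa [boostStd] using (he2.mul contDiff_const).mul hsh
  · simpa [boostStd] using (contDiff_const : ContDiff ℝ ∞ fun _ : Fin 3 → ℝ => (0 : ℂ))
  · simpa [boostStd] using he1
  · simpa [boostStd] using (contDiff_const : ContDiff ℝ ∞ fun _ : Fin 3 → ℝ => (0 : ℂ))
  · simpa [boostStd] using (he2.mul contDiff_const).mul hsh
  · simpa [boostStd] using (contDiff_const : ContDiff ℝ ∞ fun _ : Fin 3 → ℝ => (0 : ℂ))
  · simpa [boostStd] using he2.mul hch

/-- **Every entry of the split place chart `gprimeSplitGL τ a c` is smooth in `c`** (a re-indexed boost). [cite: Knapp1986, Ch. V §3] [cite: Rogawski1990, §3.6 p. 31] -/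
theorem contDiff_coe_gprimeSplitGL_apply (τ : Fin 3 ≃ Fin 3) (a : Fin 3 → ℝ) (i j : Fin 3) :
    ContDiff ℝ ∞ fun c : Fin 3 → ℝ => ((gprimeSplitGL τ a c : GL (Fin 3) ℂ) : Matrix (Fin 3) (Fin 3) ℂ) i j := by
  have h : (fun c : Fin 3 → ℝ => ((gprimeSplitGL τ a c : GL (Fin 3) ℂ) : Matrix (Fin 3) (Fin 3) ℂ) i j) =
      fun c => boostStd (a ∘ τ) c (τ.symm i) (τ.symm j) := by
    funext c
    rw [coe_gprimeSplitGL, gprimeSplitMatrix, Matrix.submatrix_apply]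
  rw [h]
  exact contDiff_boostStd_apply _ _ _

/-- **Every entry of the compact chart `gprimeCptGL τ c = diag(e^{i c (τ⁻¹ ℓ)})` is smooth in `c`.** [cite: Rogawski1990, §3.6 p. 31] -/
theorem contDiff_coe_gprimeCptGL_apply (τ : Fin 3 ≃ Fin 3) (i j : Fin 3) :
    ContDiff ℝ ∞ fun c : Fin 3 → ℝ => ((gprimeCptGL τ c : GL (Fin 3) ℂ) : Matrix (Fin 3) (Fin 3) ℂ) i j := by
  have h : (fun c : Fin 3 → ℝ => ((gprimeCptGL τ c : GL (Fin 3) ℂ) : Matrix (Fin 3) (Fin 3) ℂ) i j) =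
      fun c => if i = j then Complex.exp ((c (τ.symm i) : ℂ) * I) else 0 := by
    funext c
    rw [coe_gprimeCptGL, Matrix.diagonal_apply]
  rw [h]
  split_ifs
  · exact Complex.contDiff_exp.comp ((ofRealCLM.contDiff.comp (contDiff_apply ℝ ℝ (τ.symm i))).mul contDiff_const)
  · exact contDiff_const

variable (L : Type) [Field L] [NumberField L] [IsCMField L] (α : Fin 3 → L) (S' : Finset {w : InfinitePlace L // IsComplex w})

omit [IsCMField L] in
/-- **The entries of the `G′_w`-component `gprimeBlock α w S′ c` of the chart are smooth in the coordinates** (the boost at a split place of `S′`, the compact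
chart elsewhere; the `dite` is on the fixed data). [cite: Rogawski1990, §3.6 p. 31; §8.2 p. 122] [cite: Knapp1986, Ch. V §3] -/
theorem contDiff_coe_gprimeBlock_apply (w : {w : InfinitePlace L // IsComplex w}) (i j : Fin 3) :
    ContDiff ℝ ∞ fun c : {w : InfinitePlace L // IsComplex w} → Fin 3 → ℝ =>
      (((gprimeBlock L α w S' c : ↥(archLocal L 3 (Matrix.diagonal α) w)) : GL (Fin 3) ℂ) : Matrix (Fin 3) (Fin 3) ℂ) i j := by
  by_cases h : w ∈ S' ∧ w ∈ splitChartPlaces L α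
  · have e : (fun c : {w : InfinitePlace L // IsComplex w} → Fin 3 → ℝ =>
        (((gprimeBlock L α w S' c : ↥(archLocal L 3 (Matrix.diagonal α) w)) : GL (Fin 3) ℂ) : Matrix (Fin 3) (Fin 3) ℂ) i j) =
        fun c => ((gprimeSplitGL (lineOf (formSign L α w)) (formRe L α w) (c w) : GL (Fin 3) ℂ) : Matrix (Fin 3) (Fin 3) ℂ) i j := by
      funext c; rw [coe_gprimeBlock_of_mem L α c h.1 h.2]
    rw [e]
    exact (contDiff_coe_gprimeSplitGL_apply _ _ i j).comp (contDiff_apply ℝ (Fin 3 → ℝ) w)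
  · have e : (fun c : {w : InfinitePlace L // IsComplex w} → Fin 3 → ℝ =>
        (((gprimeBlock L α w S' c : ↥(archLocal L 3 (Matrix.diagonal α) w)) : GL (Fin 3) ℂ) : Matrix (Fin 3) (Fin 3) ℂ) i j) =
        fun c => ((gprimeCptGL (lineOf (formSign L α w)) (c w) : GL (Fin 3) ℂ) : Matrix (Fin 3) (Fin 3) ℂ) i j := by
      funext c; unfold gprimeBlock; rw [dif_neg h]
    rw [e]
    exact (contDiff_coe_gprimeCptGL_apply _ i j).comp (contDiff_apply ℝ (Fin 3 → ℝ) w)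

/-- **The matrix of `gprimeTorus α S′ c ∈ G′_∞ ≤ GL₃(L ⊗ ℝ)` entrywise**: zero real components, the `w`-component is the entry of `gprimeBlock α w S′ c`
(★ `coe_archPiEquivCM_symm_apply`). [cite: Rogawski1990, §4.3 p. 43; §3.6 p. 31] -/
theorem coe_gprimeTorus_apply (c : {w : InfinitePlace L // IsComplex w} → Fin 3 → ℝ) (i j : Fin 3) :
    (((gprimeTorus L α S' c : ↥(arch (↥(maximalRealSubfield L)) L (IsCMField.complexConj L) 3 (Matrix.diagonal α))) : GL (Fin 3) (mixedSpace L)) :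
        Matrix (Fin 3) (Fin 3) (mixedSpace L)) i j =
      ((0 : {w : InfinitePlace L // IsReal w} → ℝ),
        fun w : {w : InfinitePlace L // IsComplex w} =>
          (((gprimeBlock L α w S' c : ↥(archLocal L 3 (Matrix.diagonal α) w)) : GL (Fin 3) ℂ) : Matrix (Fin 3) (Fin 3) ℂ) i j) := by
  rw [gprimeTorus, coe_archPiEquivCM_symm_apply]
  rfl

/-- **THE CHART IS SMOOTH IN MATRIX CURRENCY**: `c ↦ gprimeTorus α S′ c ∈ M₃(L ⊗ ℝ)` is `ContDiff ℝ ∞` (entrywise, through the linear `Matrix.of`).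
[cite: Rogawski1990, §8.2 p. 122] [cite: Shelstad1979, §4 p. 22] -/
theorem contDiff_coe_gprimeTorus :
    ContDiff ℝ ∞ fun c : {w : InfinitePlace L // IsComplex w} → Fin 3 → ℝ =>
      (((gprimeTorus L α S' c : ↥(arch (↥(maximalRealSubfield L)) L (IsCMField.complexConj L) 3 (Matrix.diagonal α))) : GL (Fin 3) (mixedSpace L)) :
        Matrix (Fin 3) (Fin 3) (mixedSpace L)) := by
  let Λ : (Fin 3 → Fin 3 → mixedSpace L) →L[ℝ] Matrix (Fin 3) (Fin 3) (mixedSpace L) :=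
    LinearMap.toContinuousLinearMap (Matrix.ofLinearEquiv ℝ : (Fin 3 → Fin 3 → mixedSpace L) ≃ₗ[ℝ] Matrix (Fin 3) (Fin 3) (mixedSpace L)).toLinearMap
  have hΛ : ∀ f : Fin 3 → Fin 3 → mixedSpace L, Λ f = Matrix.of f := fun _ => rfl
  have hfun : (fun c : {w : InfinitePlace L // IsComplex w} → Fin 3 → ℝ =>
      (((gprimeTorus L α S' c : ↥(arch (↥(maximalRealSubfield L)) L (IsCMField.complexConj L) 3 (Matrix.diagonal α))) : GL (Fin 3) (mixedSpace L)) :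
        Matrix (Fin 3) (Fin 3) (mixedSpace L))) =
      fun c => Λ fun i j =>
        (((gprimeTorus L α S' c : ↥(arch (↥(maximalRealSubfield L)) L (IsCMField.complexConj L) 3 (Matrix.diagonal α))) : GL (Fin 3) (mixedSpace L)) :
          Matrix (Fin 3) (Fin 3) (mixedSpace L)) i j := by
    funext c; rw [hΛ]; rfl
  rw [hfun]
  refine Λ.contDiff.comp (contDiff_pi.2 fun i => contDiff_pi.2 fun j => ?_)
  simp only [coe_gprimeTorus_apply]
  exact contDiff_const.prodMk (contDiff_pi.2 fun w => contDiff_coe_gprimeBlock_apply L α S' w i j)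

end Chart

/-! ## §2 (HYP): the atlas `c ↦ gprimeTorus α S′ c` is uniformly proper modulo the chart torus `T_{S′}` on `RegG S′` -/

section Proper

variable (L : Type) [Field L] [NumberField L] [IsCMField L] (α : Fin 3 → L) (S' : Finset {w : InfinitePlace L // IsComplex w})

/-- **HARISH-CHANDRA'S COMPACTNESS LEMMA FOR THE ATLAS ON THE REGULAR SET, MODULO THE CHART TORUS `T_{S′}`** ((HYP) form — the binder of
★ `contDiffOn_integral_descConj_of_uniformlyProper` ∕ ★ `continuousOn_integral_descConj_of_uniformlyProper` VERBATIM, with `M := chartTorusG α S′` and `S := RegG S′`):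
for an admissible label `S′` (`S′ ⊆ splitChartPlaces`), every compact `K ⊆ RegG S′` and compact `C′ ⊆ G′_∞`, the cosets `y′ T_{S′}` with `y′ · gprimeTorus α S′ c · y′⁻¹ ∈ C′`
for some `c ∈ K` lie in ONE compact subset of `G′_∞ ⧸ T_{S′}`.  A re-reading of ★ (J-DESC) `Literature.NumberTheory.Rogawski1990.uniformlyProper_gprimeTorus_regG`
(F0P3a-p08 (g22): the `RegG S′`-box, modulo `Z(gprimeTorus α S′ c₀)` at a regular reference point `c₀`): `RegG S′` IS that box, any `c₀ ∈ K` serves, and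
`Z(gprimeTorus α S′ c₀) = T_{S′}` (★ `chartTorusG_eq_centralizer`). [cite: Rogawski1990, §4.12 Lemma 4.12.1 p. 66; §8.3 p. 122; §4.3 p. 43]
[cite: HarishChandra1970, Part I §3 Lemma 22] [cite: DeitmarEchterhoff2014, Lemma 9.3.3] -/
theorem uniformlyProper_gprimeTorus_chartTorusG_regG (hα : ∀ i, α i ≠ 0) (hS' : ∀ w, w ∈ S' → w ∈ splitChartPlaces L α) :
    ∀ K ⊆ RegG S', IsCompact K →
      ∀ C' : Set ↥(arch (↥(maximalRealSubfield L)) L (IsCMField.complexConj L) 3 (Matrix.diagonal α)), IsCompact C' →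
        ∃ 𝒦' : Set (↥(arch (↥(maximalRealSubfield L)) L (IsCMField.complexConj L) 3 (Matrix.diagonal α)) ⧸ chartTorusG L α S'),
          IsCompact 𝒦' ∧ ∀ c ∈ K, ∀ y' : ↥(arch (↥(maximalRealSubfield L)) L (IsCMField.complexConj L) 3 (Matrix.diagonal α)),
            y' * gprimeTorus L α S' c * y'⁻¹ ∈ C' →
              (QuotientGroup.mk y' : ↥(arch (↥(maximalRealSubfield L)) L (IsCMField.complexConj L) 3 (Matrix.diagonal α)) ⧸ chartTorusG L α S') ∈ 𝒦' := by
  intro K hK hKc C' hC'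
  rcases K.eq_empty_or_nonempty with rfl | ⟨c₀, hc₀⟩
  · exact ⟨∅, isCompact_empty, fun c hc => (Set.notMem_empty c hc).elim⟩
  have hreg : c₀ ∈ RegG S' := hK hc₀
  -- `RegG S′` is the product of the per-place regular sets
  have hbox : K ⊆ Set.pi Set.univ (fun w : {w : InfinitePlace L // IsComplex w} =>
      {cw : Fin 3 → ℝ | (w ∈ S' → cw 0 ≠ 0) ∧ (w ∉ S' → Function.Injective fun i : Fin 3 => Circle.exp (cw i))}) :=
    fun c hc w _ => ⟨fun hw => ((mem_regG_iff S' c).1 (hK hc)).2 w hw, fun hw => ((mem_regG_iff S' c).1 (hK hc)).1 w hw⟩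
  -- `T_{S′} = Z(gprimeTorus c₀)` at the regular point `c₀ ∈ K`
  rw [chartTorusG_eq_centralizer L α S' hα hS' hreg]
  exact Literature.NumberTheory.Rogawski1990.uniformlyProper_gprimeTorus_regG L α S' hα hS' hreg K hbox hKc C' hC'

end Proper

/-! ## §3 The head: `chartOrbG ν′ S′ a′` is `C^∞` wherever the atlas is uniformly proper, for `a′ ∈ C_c^∞(G′_∞)` -/

section Head

variable (L : Type) [Field L] [NumberField L] [IsCMField L] (α : Fin 3 → L)
  [MeasurableSpace ↥(arch (↥(maximalRealSubfield L)) L (IsCMField.complexConj L) 3 (Matrix.diagonal α))]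
  [BorelSpace ↥(arch (↥(maximalRealSubfield L)) L (IsCMField.complexConj L) 3 (Matrix.diagonal α))]
  (ν' : Measure ↥(arch (↥(maximalRealSubfield L)) L (IsCMField.complexConj L) 3 (Matrix.diagonal α))) [IsFiniteMeasureOnCompacts ν'] [ν'.IsMulRightInvariant]
  (S' : Finset {w : InfinitePlace L // IsComplex w})

/-- **THE HEAD, (HYP)-BINDER FORM: `c ↦ chartOrbG ν′ S′ a′ c` IS `C^∞` ON EVERY OPEN SET `U` OF COORDINATES ON WHICH THE ATLAS IS UNIFORMLY PROPER MODULO `T_{S′}`**,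
for every `a′ ∈ C_c^∞(G′_∞)` (★ `ArchSmooth`) and every `ν′` finite on compacts and right invariant — Harish-Chandra's smoothness of ordinary orbital integrals by
differentiation under the quotient integral (★ `contDiffOn_integral_descConj_of_uniformlyProper`), with the smooth factorisation
`a′(y · γ′(c) · y⁻¹) = Θ((Ad(y) ∘ π_{S′})(γ′(c)))`, `Θ` the ambient smooth lift of `a′` (★ `ArchSmooth.exists_contDiff`), `π_{S′}` a linear projection of `M₃(L ⊗ ℝ)` onto the
commutant of `T_{S′}` (through which `γ′(c) = gprimeTorus α S′ c` factors since it commutes with `T_{S′}`).  The `G′`-side twin of ★ `contDiffOn_chartOrbH_regS`.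
[cite: Rogawski1990, §8.3 pp. 122–124] [cite: Shelstad1979, §4 pp. 22–23] [cite: Varadarajan1989, §2.4 Thm. 8] [cite: HormanderALPDO1, Thm. 1.1.9] -/
theorem contDiffOn_chartOrbG_of_uniformlyProper {U : Set ({w : InfinitePlace L // IsComplex w} → Fin 3 → ℝ)} (hU : IsOpen U)
    (hprop : ∀ K ⊆ U, IsCompact K →
      ∀ C' : Set ↥(arch (↥(maximalRealSubfield L)) L (IsCMField.complexConj L) 3 (Matrix.diagonal α)), IsCompact C' →
        ∃ 𝒦' : Set (↥(arch (↥(maximalRealSubfield L)) L (IsCMField.complexConj L) 3 (Matrix.diagonal α)) ⧸ chartTorusG L α S'),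
          IsCompact 𝒦' ∧ ∀ c ∈ K, ∀ y' : ↥(arch (↥(maximalRealSubfield L)) L (IsCMField.complexConj L) 3 (Matrix.diagonal α)),
            y' * gprimeTorus L α S' c * y'⁻¹ ∈ C' →
              (QuotientGroup.mk y' : ↥(arch (↥(maximalRealSubfield L)) L (IsCMField.complexConj L) 3 (Matrix.diagonal α)) ⧸ chartTorusG L α S') ∈ 𝒦')
    {a' : ↥(arch (↥(maximalRealSubfield L)) L (IsCMField.complexConj L) 3 (Matrix.diagonal α)) → ℂ} (ha' : ArchSmooth L 3 (Matrix.diagonal α) a') :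
    ContDiffOn ℝ ∞ (chartOrbG L α ν' S' a') U := by
  letI : MeasurableSpace (↥(arch (↥(maximalRealSubfield L)) L (IsCMField.complexConj L) 3 (Matrix.diagonal α)) ⧸ chartTorusG L α S') := borel _
  haveI : BorelSpace (↥(arch (↥(maximalRealSubfield L)) L (IsCMField.complexConj L) 3 (Matrix.diagonal α)) ⧸ chartTorusG L α S') := ⟨rfl⟩
  haveI : IsFiniteMeasureOnCompacts (chartQuotientMeasureG L α ν' S') := by
    unfold chartQuotientMeasureG
    infer_instance
  haveI : IsClosed (chartTorusG L α S' : Set ↥(arch (↥(maximalRealSubfield L)) L (IsCMField.complexConj L) 3 (Matrix.diagonal α))) := isClosed_chartTorusG L α S'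
  obtain ⟨Θ, hΘ, -, -, hΘf⟩ := ha'.exists_contDiff
  -- the ambient reading `G′_∞ → M₃(L ⊗ ℝ)`
  let Ebar : ↥(arch (↥(maximalRealSubfield L)) L (IsCMField.complexConj L) 3 (Matrix.diagonal α)) → Matrix (Fin 3) (Fin 3) (mixedSpace L) :=
    fun k => ((k : GL (Fin 3) (mixedSpace L)) : Matrix (Fin 3) (Fin 3) (mixedSpace L))
  have hEmul : ∀ x y, Ebar (x * y) = Ebar x * Ebar y := fun x y => by
    simp only [Ebar, Subgroup.coe_mul, Units.val_mul]
  have hEone : Ebar 1 = 1 := by simp only [Ebar, OneMemClass.coe_one, Units.val_one]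
  have hEinv : ∀ x, Ebar x * Ebar x⁻¹ = 1 := fun x => by rw [← hEmul, mul_inv_cancel, hEone]
  have hEcont : Continuous Ebar := Units.continuous_val.comp continuous_subtype_val
  -- the commutant of `T_{S′}` in `M₃(L ⊗ ℝ)` and a linear projection onto it
  let A : Submodule ℝ (Matrix (Fin 3) (Fin 3) (mixedSpace L)) :=
    { carrier := {m | ∀ s ∈ chartTorusG L α S', Ebar s * m = m * Ebar s}
      add_mem' := fun {a b} ha hb s hs => by rw [mul_add, add_mul, ha s hs, hb s hs]
      zero_mem' := fun s _ => by rw [mul_zero, zero_mul]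
      smul_mem' := fun r m hm s hs => by
        show Ebar s * (r • m) = r • m * Ebar s
        rw [mul_smul_comm, smul_mul_assoc, hm s hs] }
  have hAmem : ∀ m, m ∈ A ↔ ∀ s ∈ chartTorusG L α S', Ebar s * m = m * Ebar s := fun _ => Iff.rfl
  obtain ⟨B, hAB⟩ := A.exists_isCompl
  -- a basis of the commutant and its coordinate functionals
  let b := Module.finBasis ℝ A
  let ℓ : Fin (Module.finrank ℝ A) → Matrix (Fin 3) (Fin 3) (mixedSpace L) →ₗ[ℝ] ℝ := fun k => (b.coord k) ∘ₗ (A.projectionOnto B hAB)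
  have hℓ : ∀ k, ContDiff ℝ ∞ fun m : Matrix (Fin 3) (Fin 3) (mixedSpace L) => ℓ k m := fun k =>
    (LinearMap.toContinuousLinearMap (ℓ k)).contDiff
  have hrec : ∀ m ∈ A, ∑ k, ℓ k m • ((b k : A) : Matrix (Fin 3) (Fin 3) (mixedSpace L)) = m := by
    intro m hm
    have h1 : A.projectionOnto B hAB m = ⟨m, hm⟩ := Submodule.projectionOnto_apply_of_mem_left hAB hm
    have h2 := congrArg (fun x : A => (x : Matrix (Fin 3) (Fin 3) (mixedSpace L))) (b.sum_repr (⟨m, hm⟩ : A))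
    simp only [AddSubmonoidClass.coe_finsetSum, SetLike.val_smul] at h2
    have h3 : ∀ k, ℓ k m = b.repr (⟨m, hm⟩ : A) k := fun k => by
      show b.coord k (A.projectionOnto B hAB m) = _
      rw [h1, Module.Basis.coord_apply]
    simp only [h3]
    exact h2
  -- the `T_{S′}`-invariant datum `p(y) = (Ad(y) b_k)_k`
  let p : ↥(arch (↥(maximalRealSubfield L)) L (IsCMField.complexConj L) 3 (Matrix.diagonal α)) → Fin (Module.finrank ℝ A) → Matrix (Fin 3) (Fin 3) (mixedSpace L) :=
    fun h k => Ebar h * ((b k : A) : Matrix (Fin 3) (Fin 3) (mixedSpace L)) * Ebar h⁻¹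
  have hp : Continuous p :=
    continuous_pi fun k => (hEcont.mul continuous_const).mul (hEcont.comp continuous_inv)
  have hpM : ∀ y, ∀ m ∈ chartTorusG L α S', p (y * m) = p y := by
    intro y s hs
    funext k
    have hc : Ebar s * ((b k : A) : Matrix (Fin 3) (Fin 3) (mixedSpace L)) = ((b k : A) : Matrix (Fin 3) (Fin 3) (mixedSpace L)) * Ebar s :=
      (hAmem _).1 (b k).2 s hs
    show Ebar (y * s) * ((b k : A) : Matrix (Fin 3) (Fin 3) (mixedSpace L)) * Ebar (y * s)⁻¹ =
      Ebar y * ((b k : A) : Matrix (Fin 3) (Fin 3) (mixedSpace L)) * Ebar y⁻¹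
    rw [_root_.mul_inv_rev, hEmul, hEmul]
    calc Ebar y * Ebar s * ((b k : A) : Matrix (Fin 3) (Fin 3) (mixedSpace L)) * (Ebar s⁻¹ * Ebar y⁻¹)
        = Ebar y * (Ebar s * ((b k : A) : Matrix (Fin 3) (Fin 3) (mixedSpace L)) * Ebar s⁻¹) * Ebar y⁻¹ := by simp only [mul_assoc]
      _ = Ebar y * ((b k : A) : Matrix (Fin 3) (Fin 3) (mixedSpace L)) * Ebar y⁻¹ := by
          rw [hc, mul_assoc (((b k : A) : Matrix (Fin 3) (Fin 3) (mixedSpace L))), hEinv, mul_one]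
  -- the smooth factorisation `Ψ(m, c) = Θ(∑_k ℓ_k(γ′(c)) • m_k)`
  let Ψ : (Fin (Module.finrank ℝ A) → Matrix (Fin 3) (Fin 3) (mixedSpace L)) × ({w : InfinitePlace L // IsComplex w} → Fin 3 → ℝ) → ℂ :=
    fun q => Θ (∑ k, ℓ k (Ebar (gprimeTorus L α S' q.2)) • q.1 k)
  have hΨ : ContDiff ℝ ∞ Ψ := by
    refine hΘ.comp (ContDiff.sum fun k _ => ?_)
    have h1 : ContDiff ℝ ∞ fun q : (Fin (Module.finrank ℝ A) → Matrix (Fin 3) (Fin 3) (mixedSpace L)) × ({w : InfinitePlace L // IsComplex w} → Fin 3 → ℝ) =>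
        ℓ k (Ebar (gprimeTorus L α S' q.2)) :=
      (hℓ k).comp ((contDiff_coe_gprimeTorus L α S').comp contDiff_snd)
    have h2 : ContDiff ℝ ∞ fun q : (Fin (Module.finrank ℝ A) → Matrix (Fin 3) (Fin 3) (mixedSpace L)) × ({w : InfinitePlace L // IsComplex w} → Fin 3 → ℝ) =>
        q.1 k := (contDiff_apply ℝ (Matrix (Fin 3) (Fin 3) (mixedSpace L)) k).comp contDiff_fst
    exact h1.smul h2
  have hfac : ∀ y c, a' (y * gprimeTorus L α S' c * y⁻¹) = Ψ (p y, c) := by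
    intro y c
    have hmem : Ebar (gprimeTorus L α S' c) ∈ A := fun s hs => by
      rw [← hEmul, ← hEmul, forall_mem_chartTorusG_comm L α S' c s hs]
    have hsum : ∑ k, ℓ k (Ebar (gprimeTorus L α S' c)) • p y k =
        Ebar y * (∑ k, ℓ k (Ebar (gprimeTorus L α S' c)) • ((b k : A) : Matrix (Fin 3) (Fin 3) (mixedSpace L))) * Ebar y⁻¹ := by
      rw [Finset.mul_sum, Finset.sum_mul]
      exact Finset.sum_congr rfl fun k _ => by rw [mul_smul_comm, smul_mul_assoc]
    show a' _ = Θ (∑ k, ℓ k (Ebar (gprimeTorus L α S' c)) • p y k)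
    rw [hsum, hrec _ hmem, ← hEmul, ← hEmul]
    exact hΘf _
  have h := Literature.MeasureTheory.Group.contDiffOn_integral_descConj_of_uniformlyProper (chartTorusG L α S')
    (forall_mem_chartTorusG_comm L α S') hU hprop (chartQuotientMeasureG L α ν' S')
    ha'.hasCompactSupport p hp hpM Ψ hΨ hfac
  have hEq : chartOrbG L α ν' S' a' = fun c => ((chartHaarG L α S' (chartBoxImgG L α S')).toReal : ℂ) *
      ∫ q, Literature.MeasureTheory.Group.descConj (gprimeTorus L α S' c) (chartTorusG L α S') (forall_mem_chartTorusG_comm L α S' c) a' q ∂(chartQuotientMeasureG L α ν' S') :=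
    funext fun c => chartOrbG_def L α ν' S' a' c
  rw [hEq]
  exact contDiffOn_const.mul h

/-- **«(I₂-RegG-G′)»: `c ↦ chartOrbG ν′ S′ a′ c` IS `C^∞` ON THE REGULAR SET `RegG S′` OF EVERY ADMISSIBLE CHART**, for every `a′ ∈ C_c^∞(G′_∞)` and every `ν′`
finite on compacts and right invariant — clause (I₁)∕(I₂) of letter L1 (`HcOrbitalFamiliesStatement`) AWAY FROM THE WALLS for the genuine chart functional; §2 ∘ the head.
[cite: Rogawski1990, §8.3 pp. 122–124] [cite: Shelstad1979, §4 pp. 22–23] [cite: Bouaziz1994IntegralesOrbitales, §3.2 p. 580] [cite: Varadarajan1989, §2.4 Thm. 8] -/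
theorem contDiffOn_chartOrbG_regG (hα : ∀ i, α i ≠ 0) (hS' : ∀ w, w ∈ S' → w ∈ splitChartPlaces L α)
    {a' : ↥(arch (↥(maximalRealSubfield L)) L (IsCMField.complexConj L) 3 (Matrix.diagonal α)) → ℂ} (ha' : ArchSmooth L 3 (Matrix.diagonal α) a') :
    ContDiffOn ℝ ∞ (chartOrbG L α ν' S' a') (RegG S') :=
  contDiffOn_chartOrbG_of_uniformlyProper L α ν' S' (isOpen_regG S') (uniformlyProper_gprimeTorus_chartTorusG_regG L α S' hα hS') ha'

end Head

end Literature.NumberTheory.Automorphic.UnitaryGroup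

/-! ## §4 Shelstad's normaliser `archRG S′` and the ordinary orbital family `orbFamG ν′ a′ S′` are `C^∞` on `RegG S′` -/

namespace Literature.NumberTheory.Automorphic.ArchCartan

section Coord

variable {W : Type*} [Fintype W] [DecidableEq W]

/-- `e^{±x + iθ} ≠ e^{iφ}` off the real wall `x = 0` (the moduli are `e^{±x} ≠ 1`). [cite: Shelstad1979, §4 p. 22] [cite: Rogawski1990, §8.2 p. 118] -/
theorem cexp_add_mul_I_sub_cexp_mul_I_ne_zero {x : ℝ} (hx : x ≠ 0) (θ φ : ℝ) :
    Complex.exp ((x : ℂ) + (θ : ℂ) * I) - Complex.exp ((φ : ℂ) * I) ≠ 0 := by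
  intro h
  have h' := congrArg (fun z : ℂ => ‖z‖) (sub_eq_zero.1 h)
  simp only [Complex.norm_exp, Complex.add_re, Complex.ofReal_re, Complex.mul_re, Complex.I_re, Complex.I_im, Complex.ofReal_im,
    mul_zero, mul_one, sub_zero, add_zero] at h'
  have : x = 0 := by simpa using Real.exp_injective (h'.trans (by simp))
  exact hx this

/-- **Shelstad's normaliser `archRG S′` is smooth on `RegG S′`** (`|e^x − e^{−x}|` and the two moduli `|e^{±x+iθ} − e^{iφ}|` are smooth off their zero sets, which
miss `RegG S′`; the compact-place factors `1 − e^{i(θ_j − θ_i)}` are entire). [cite: Shelstad1979, §4 p. 22] [cite: Rogawski1990, §8.2 p. 118]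
[cite: Bouaziz1994IntegralesOrbitales, §3.2 p. 580] -/
theorem contDiffOn_archRG_regG (S' : Finset W) : ContDiffOn ℝ ∞ (archRG S') (RegG S') := by
  unfold archRG
  refine contDiffOn_prod fun w _ => ?_
  by_cases hw : w ∈ S'
  · simp only [if_pos hw]
    intro c hc
    have hx : c w 0 ≠ 0 := ((mem_regG_iff S' c).1 hc).2 w hw
    have hne : Real.exp (c w 0) - Real.exp (-c w 0) ≠ 0 := by
      intro h0
      have h' : c w 0 = -c w 0 := Real.exp_injective (sub_eq_zero.1 h0)
      exact hx (by linarith)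
    have h0 : ContDiff ℝ ∞ fun c : W → Fin 3 → ℝ => c w 0 := contDiff_apply_apply ℝ ℝ w 0
    have h1 : ContDiff ℝ ∞ fun c : W → Fin 3 → ℝ => c w 1 := contDiff_apply_apply ℝ ℝ w 1
    have h2 : ContDiff ℝ ∞ fun c : W → Fin 3 → ℝ => c w 2 := contDiff_apply_apply ℝ ℝ w 2
    have hg : ContDiff ℝ ∞ fun c : W → Fin 3 → ℝ => Real.exp (c w 0) - Real.exp (-c w 0) :=
      (Real.contDiff_exp.comp h0).sub (Real.contDiff_exp.comp h0.neg)
    have hz₁ : ContDiff ℝ ∞ fun c : W → Fin 3 → ℝ => Complex.exp ((c w 0 : ℂ) + (c w 2 : ℂ) * I) - Complex.exp ((c w 1 : ℂ) * I) :=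
      (Complex.contDiff_exp.comp ((ofRealCLM.contDiff.comp h0).add ((ofRealCLM.contDiff.comp h2).mul contDiff_const))).sub
        (Complex.contDiff_exp.comp ((ofRealCLM.contDiff.comp h1).mul contDiff_const))
    have hz₂ : ContDiff ℝ ∞ fun c : W → Fin 3 → ℝ => Complex.exp (-(c w 0 : ℂ) + (c w 2 : ℂ) * I) - Complex.exp ((c w 1 : ℂ) * I) :=
      (Complex.contDiff_exp.comp ((ofRealCLM.contDiff.comp h0).neg.add ((ofRealCLM.contDiff.comp h2).mul contDiff_const))).sub
        (Complex.contDiff_exp.comp ((ofRealCLM.contDiff.comp h1).mul contDiff_const))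
    have hne₁ : Complex.exp ((c w 0 : ℂ) + (c w 2 : ℂ) * I) - Complex.exp ((c w 1 : ℂ) * I) ≠ 0 :=
      cexp_add_mul_I_sub_cexp_mul_I_ne_zero hx _ _
    have hne₂ : Complex.exp (-(c w 0 : ℂ) + (c w 2 : ℂ) * I) - Complex.exp ((c w 1 : ℂ) * I) ≠ 0 := by
      have h := cexp_add_mul_I_sub_cexp_mul_I_ne_zero (neg_ne_zero.2 hx) (c w 2) (c w 1)
      simpa using h
    have hA : ContDiffAt ℝ ∞ (fun c : W → Fin 3 → ℝ => |Real.exp (c w 0) - Real.exp (-c w 0)|) c := hg.contDiffAt.abs hne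
    have hB : ContDiffAt ℝ ∞ (fun c : W → Fin 3 → ℝ => ‖Complex.exp ((c w 0 : ℂ) + (c w 2 : ℂ) * I) - Complex.exp ((c w 1 : ℂ) * I)‖) c :=
      hz₁.contDiffAt.norm ℝ hne₁
    have hC : ContDiffAt ℝ ∞ (fun c : W → Fin 3 → ℝ => ‖Complex.exp (-(c w 0 : ℂ) + (c w 2 : ℂ) * I) - Complex.exp ((c w 1 : ℂ) * I)‖) c :=
      hz₂.contDiffAt.norm ℝ hne₂
    exact (ofRealCLM.contDiff.contDiffAt.comp c ((hA.mul hB).mul hC)).contDiffWithinAt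
  · simp only [if_neg hw]
    have he : ∀ i j : Fin 3, ContDiff ℝ ∞ fun c : W → Fin 3 → ℝ => (Circle.exp (c w j - c w i) : ℂ) := by
      intro i j
      have h : (fun c : W → Fin 3 → ℝ => (Circle.exp (c w j - c w i) : ℂ)) = fun c => Complex.exp (((c w j - c w i : ℝ) : ℂ) * I) :=
        funext fun c => Circle.coe_exp _
      rw [h]
      exact Complex.contDiff_exp.comp
        ((ofRealCLM.contDiff.comp ((contDiff_apply_apply ℝ ℝ w j).sub (contDiff_apply_apply ℝ ℝ w i))).mul contDiff_const)
    exact (((contDiff_const.sub (he 0 1)).mul (contDiff_const.sub (he 0 2))).mul (contDiff_const.sub (he 1 2))).contDiffOn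

end Coord

end Literature.NumberTheory.Automorphic.ArchCartan

namespace Literature.NumberTheory.Rogawski1990

section Family

variable (L : Type) [Field L] [NumberField L] [IsCMField L] (α : Fin 3 → L)
  [MeasurableSpace ↥(arch (↥(maximalRealSubfield L)) L (IsCMField.complexConj L) 3 (Matrix.diagonal α))]
  [BorelSpace ↥(arch (↥(maximalRealSubfield L)) L (IsCMField.complexConj L) 3 (Matrix.diagonal α))]
  (ν' : Measure ↥(arch (↥(maximalRealSubfield L)) L (IsCMField.complexConj L) 3 (Matrix.diagonal α))) [IsFiniteMeasureOnCompacts ν'] [ν'.IsMulRightInvariant]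

/-- **THE ORDINARY ORBITAL FAMILY IS `C^∞` WHEREVER THE ATLAS IS UNIFORMLY PROPER INSIDE `RegG S′`** ((HYP)-binder form): `orbFamG ν′ a′ S′ = R′ · chartOrbG` on the
admissible label `S′` (★ `orbFamG_apply`), `R′ = archRG S′` smooth on `RegG S′` (§4a) and `chartOrbG` smooth on `U` (§3). [cite: Shelstad1979, §4 p. 22]
[cite: Rogawski1990, §8.3 pp. 122–124] [cite: Bouaziz1994IntegralesOrbitales, §3.1–3.2 pp. 579–580] -/
theorem contDiffOn_orbFamG_of_uniformlyProper (S' : Finset {w : InfinitePlace L // IsComplex w}) (hS' : ∀ w, w ∈ S' → w ∈ splitChartPlaces L α)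
    {U : Set ({w : InfinitePlace L // IsComplex w} → Fin 3 → ℝ)} (hU : IsOpen U) (hUreg : U ⊆ RegG S')
    (hprop : ∀ K ⊆ U, IsCompact K →
      ∀ C' : Set ↥(arch (↥(maximalRealSubfield L)) L (IsCMField.complexConj L) 3 (Matrix.diagonal α)), IsCompact C' →
        ∃ 𝒦' : Set (↥(arch (↥(maximalRealSubfield L)) L (IsCMField.complexConj L) 3 (Matrix.diagonal α)) ⧸ chartTorusG L α S'),
          IsCompact 𝒦' ∧ ∀ c ∈ K, ∀ y' : ↥(arch (↥(maximalRealSubfield L)) L (IsCMField.complexConj L) 3 (Matrix.diagonal α)),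
            y' * gprimeTorus L α S' c * y'⁻¹ ∈ C' →
              (QuotientGroup.mk y' : ↥(arch (↥(maximalRealSubfield L)) L (IsCMField.complexConj L) 3 (Matrix.diagonal α)) ⧸ chartTorusG L α S') ∈ 𝒦')
    {a' : ↥(arch (↥(maximalRealSubfield L)) L (IsCMField.complexConj L) 3 (Matrix.diagonal α)) → ℂ} (ha' : ArchSmooth L 3 (Matrix.diagonal α) a') :
    ContDiffOn ℝ ∞ (orbFamG L α ν' a' S') U := by
  have hEq : orbFamG L α ν' a' S' = fun c => archRG S' c * chartOrbG L α ν' S' a' c := funext fun c => orbFamG_apply L α ν' a' hS' c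
  rw [hEq]
  exact ((contDiffOn_archRG_regG S').mono hUreg).mul (contDiffOn_chartOrbG_of_uniformlyProper L α ν' S' hU hprop ha')

/-- **«(I₂-RegG-G′)» FOR THE ORDINARY ORBITAL FAMILY**: on an admissible label `S′` the genuine family `orbFamG ν′ a′ S′ = R′ · Φ` of every `a′ ∈ C_c^∞(G′_∞)` is `C^∞` on the
regular set `RegG S′` — clause (I₁)∕(I₂) of Harish-Chandra's letter L1 (`HcOrbitalFamiliesStatement`: `orbFamGExt ν′ a′ ∈ ArchHCSpaceG`) AWAY FROM ALL WALLS (on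
`RegG S′ ⊆ InRegG s S′` the extended family `orbFamGExt` IS `orbFamG`, ★ `orbFamGExt_eqOn_regG`).  The `G′`-side twin of ★ `contDiffOn_stOrbFamH_regS`.
[cite: Shelstad1979, §4 pp. 22–23] [cite: Rogawski1990, §8.3 pp. 122–124] [cite: Bouaziz1994IntegralesOrbitales, §3.2 p. 580] [cite: Varadarajan1989, §2.4 Thm. 8] -/
theorem contDiffOn_orbFamG_regG (S' : Finset {w : InfinitePlace L // IsComplex w}) (hα : ∀ i, α i ≠ 0) (hS' : ∀ w, w ∈ S' → w ∈ splitChartPlaces L α)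
    {a' : ↥(arch (↥(maximalRealSubfield L)) L (IsCMField.complexConj L) 3 (Matrix.diagonal α)) → ℂ} (ha' : ArchSmooth L 3 (Matrix.diagonal α) a') :
    ContDiffOn ℝ ∞ (orbFamG L α ν' a' S') (RegG S') :=
  contDiffOn_orbFamG_of_uniformlyProper L α ν' S' hS' (isOpen_regG S') subset_rfl (uniformlyProper_gprimeTorus_chartTorusG_regG L α S' hα hS') ha'

/-- **On a JUNK label the family is the zero family, smooth everywhere** (★ `orbFamG_of_not`) — so `orbFamG ν′ a′ S′` is `C^∞` on `RegG S′` for EVERY label `S′`.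
[cite: Shelstad1979, §4 p. 22] [cite: Bouaziz1994IntegralesOrbitales, §3.1 p. 579] -/
theorem contDiffOn_orbFamG_regG' (S' : Finset {w : InfinitePlace L // IsComplex w}) (hα : ∀ i, α i ≠ 0)
    {a' : ↥(arch (↥(maximalRealSubfield L)) L (IsCMField.complexConj L) 3 (Matrix.diagonal α)) → ℂ} (ha' : ArchSmooth L 3 (Matrix.diagonal α) a') :
    ContDiffOn ℝ ∞ (orbFamG L α ν' a' S') (RegG S') := by
  by_cases hS' : ∀ w, w ∈ S' → w ∈ splitChartPlaces L α
  · exact contDiffOn_orbFamG_regG L α ν' S' hα hS' ha'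
  · rw [orbFamG_of_not L α ν' a' hS']
    exact contDiffOn_const

end Family

end Literature.NumberTheory.Rogawski1990

/-! ## ED. 2 (append-only; ED. 1 = p850500 byte-identical above) — §5 the `C⁰` twins for `a′ ∈ C_c(G′_∞)`; §6 the heads in `orbFamGExt` currency

§5: for merely CONTINUOUS compactly supported `a′` the same (HYP) (§2) feeds ★ `continuousOn_integral_descConj_of_uniformlyProper` — `chartOrbG ν′ S′ a′` and `orbFamG ν′ a′ S′`
are `ContinuousOn (RegG S′)` (the `G′`-side twin of ★ `continuousOn_chartOrbH_regS`, the (W1-cont) clause for the atlas of record).  §6: on `RegG S′` the wall-extended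
family ★ `orbFamGExt` agrees with `orbFamG` (★ `orbFamGExt_eqOn_regG`), so the §4∕§5 heads transfer VERBATIM — the regular-set restriction of the `hsm` antecedent
`ContDiffOn ℝ ∞ (orbFamGExt …) (InRegG s S′)` of ★ (V1-G′) `ArchCayleyValueOfMembership` ∕ ★ (J-G′-SIDE), hypothesis-free for the genuine family. -/

namespace Literature.NumberTheory.Automorphic.UnitaryGroup

section HeadC0

variable (L : Type) [Field L] [NumberField L] [IsCMField L] (α : Fin 3 → L)
  [MeasurableSpace ↥(arch (↥(maximalRealSubfield L)) L (IsCMField.complexConj L) 3 (Matrix.diagonal α))]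
  [BorelSpace ↥(arch (↥(maximalRealSubfield L)) L (IsCMField.complexConj L) 3 (Matrix.diagonal α))]
  (ν' : Measure ↥(arch (↥(maximalRealSubfield L)) L (IsCMField.complexConj L) 3 (Matrix.diagonal α))) [IsFiniteMeasureOnCompacts ν'] [ν'.IsMulRightInvariant]
  (S' : Finset {w : InfinitePlace L // IsComplex w})

/-- **`C⁰` HEAD, (HYP)-BINDER FORM: `c ↦ chartOrbG ν′ S′ a′ c` IS CONTINUOUS ON EVERY OPEN SET ON WHICH THE ATLAS IS UNIFORMLY PROPER MODULO `T_{S′}`**, for every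
`a′ ∈ C_c(G′_∞)` (★ `continuousOn_integral_descConj_of_uniformlyProper`; ★ `continuous_gprimeTorus`).  The `G′`-side twin of ★ `continuousOn_chartOrbH_regS`.
[cite: Rogawski1990, §8.3 pp. 122–124] [cite: Shelstad1979, §4 pp. 22–23] [cite: DeitmarEchterhoff2014, Lemma 9.3.3; Thm. 1.5.3] -/
theorem continuousOn_chartOrbG_of_uniformlyProper {U : Set ({w : InfinitePlace L // IsComplex w} → Fin 3 → ℝ)} (hU : IsOpen U)
    (hprop : ∀ K ⊆ U, IsCompact K →
      ∀ C' : Set ↥(arch (↥(maximalRealSubfield L)) L (IsCMField.complexConj L) 3 (Matrix.diagonal α)), IsCompact C' →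
        ∃ 𝒦' : Set (↥(arch (↥(maximalRealSubfield L)) L (IsCMField.complexConj L) 3 (Matrix.diagonal α)) ⧸ chartTorusG L α S'),
          IsCompact 𝒦' ∧ ∀ c ∈ K, ∀ y' : ↥(arch (↥(maximalRealSubfield L)) L (IsCMField.complexConj L) 3 (Matrix.diagonal α)),
            y' * gprimeTorus L α S' c * y'⁻¹ ∈ C' →
              (QuotientGroup.mk y' : ↥(arch (↥(maximalRealSubfield L)) L (IsCMField.complexConj L) 3 (Matrix.diagonal α)) ⧸ chartTorusG L α S') ∈ 𝒦')
    {a' : ↥(arch (↥(maximalRealSubfield L)) L (IsCMField.complexConj L) 3 (Matrix.diagonal α)) → ℂ} (ha' : Continuous a') (ha'c : HasCompactSupport a') :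
    ContinuousOn (chartOrbG L α ν' S' a') U := by
  letI : MeasurableSpace (↥(arch (↥(maximalRealSubfield L)) L (IsCMField.complexConj L) 3 (Matrix.diagonal α)) ⧸ chartTorusG L α S') := borel _
  haveI : BorelSpace (↥(arch (↥(maximalRealSubfield L)) L (IsCMField.complexConj L) 3 (Matrix.diagonal α)) ⧸ chartTorusG L α S') := ⟨rfl⟩
  haveI : IsFiniteMeasureOnCompacts (chartQuotientMeasureG L α ν' S') := by
    unfold chartQuotientMeasureG
    infer_instance
  have h := continuousOn_integral_descConj_of_uniformlyProper (chartTorusG L α S') (continuous_gprimeTorus L α S')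
    (forall_mem_chartTorusG_comm L α S') hU hprop (chartQuotientMeasureG L α ν' S') ha' ha'c
  have hEq : chartOrbG L α ν' S' a' = fun c => ((chartHaarG L α S' (chartBoxImgG L α S')).toReal : ℂ) *
      ∫ q, Literature.MeasureTheory.Group.descConj (gprimeTorus L α S' c) (chartTorusG L α S') (forall_mem_chartTorusG_comm L α S' c) a' q ∂(chartQuotientMeasureG L α ν' S') :=
    funext fun c => chartOrbG_def L α ν' S' a' c
  rw [hEq]
  exact continuousOn_const.mul h

/-- **«(W1-cont-RegG-G′)»: `c ↦ chartOrbG ν′ S′ a′ c` IS CONTINUOUS ON `RegG S′`** for every admissible label `S′` and every `a′ ∈ C_c(G′_∞)` (§2 ∘ §5).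
[cite: Rogawski1990, §8.3 pp. 122–124] [cite: Shelstad1979, §4 pp. 22–23] [cite: DeitmarEchterhoff2014, Lemma 9.3.3] -/
theorem continuousOn_chartOrbG_regG (hα : ∀ i, α i ≠ 0) (hS' : ∀ w, w ∈ S' → w ∈ splitChartPlaces L α)
    {a' : ↥(arch (↥(maximalRealSubfield L)) L (IsCMField.complexConj L) 3 (Matrix.diagonal α)) → ℂ} (ha' : Continuous a') (ha'c : HasCompactSupport a') :
    ContinuousOn (chartOrbG L α ν' S' a') (RegG S') :=
  continuousOn_chartOrbG_of_uniformlyProper L α ν' S' (isOpen_regG S') (uniformlyProper_gprimeTorus_chartTorusG_regG L α S' hα hS') ha' ha'c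

end HeadC0

end Literature.NumberTheory.Automorphic.UnitaryGroup

namespace Literature.NumberTheory.Rogawski1990

section FamilyC0

variable (L : Type) [Field L] [NumberField L] [IsCMField L] (α : Fin 3 → L)
  [MeasurableSpace ↥(arch (↥(maximalRealSubfield L)) L (IsCMField.complexConj L) 3 (Matrix.diagonal α))]
  [BorelSpace ↥(arch (↥(maximalRealSubfield L)) L (IsCMField.complexConj L) 3 (Matrix.diagonal α))]
  (ν' : Measure ↥(arch (↥(maximalRealSubfield L)) L (IsCMField.complexConj L) 3 (Matrix.diagonal α))) [IsFiniteMeasureOnCompacts ν'] [ν'.IsMulRightInvariant]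
  (S' : Finset {w : InfinitePlace L // IsComplex w})

/-- **The ordinary orbital family of `a′ ∈ C_c(G′_∞)` is CONTINUOUS on `RegG S′`** (every label: on a junk label it is the zero family).  [cite: Shelstad1979, §4 pp. 22–23]
[cite: Rogawski1990, §8.3 pp. 122–124] -/
theorem continuousOn_orbFamG_regG (hα : ∀ i, α i ≠ 0)
    {a' : ↥(arch (↥(maximalRealSubfield L)) L (IsCMField.complexConj L) 3 (Matrix.diagonal α)) → ℂ} (ha' : Continuous a') (ha'c : HasCompactSupport a') :
    ContinuousOn (orbFamG L α ν' a' S') (RegG S') := by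
  by_cases hS' : ∀ w, w ∈ S' → w ∈ splitChartPlaces L α
  · have hEq : orbFamG L α ν' a' S' = fun c => archRG S' c * chartOrbG L α ν' S' a' c := funext fun c => orbFamG_apply L α ν' a' hS' c
    rw [hEq]
    exact (contDiffOn_archRG_regG S').continuousOn.mul (continuousOn_chartOrbG_regG L α ν' S' hα hS' ha' ha'c)
  · rw [orbFamG_of_not L α ν' a' hS']
    exact continuousOn_const

/-- **«(I₂-RegG-G′)» IN `orbFamGExt` CURRENCY: the WALL-EXTENDED genuine family is `C^∞` on `RegG S′`** for `a′ ∈ C_c^∞(G′_∞)` and every label `S′` — the `RegG`-restriction of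
the `hsm` antecedent `ContDiffOn ℝ ∞ (orbFamGExt …) (InRegG s S′)` of ★ (V1-G′) ∕ (J-G′-SIDE), hypothesis-free (★ `orbFamGExt_eqOn_regG` ∘ §4). [cite: Varadarajan1977, I §1.12]
[cite: Shelstad1979, §4 pp. 22–24] [cite: Bouaziz1994IntegralesOrbitales, §3.2 p. 580] -/
theorem contDiffOn_orbFamGExt_regG (hα : ∀ i, α i ≠ 0)
    {a' : ↥(arch (↥(maximalRealSubfield L)) L (IsCMField.complexConj L) 3 (Matrix.diagonal α)) → ℂ} (ha' : ArchSmooth L 3 (Matrix.diagonal α) a') :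
    ContDiffOn ℝ ∞ (orbFamGExt L α ν' a' S') (RegG S') :=
  (contDiffOn_orbFamG_regG' L α ν' S' hα ha').congr (orbFamGExt_eqOn_regG L α ν' a' S')

/-- **The wall-extended genuine family of `a′ ∈ C_c(G′_∞)` is CONTINUOUS on `RegG S′`.** [cite: Varadarajan1977, I §1.12] [cite: Shelstad1979, §4 pp. 22–24] -/
theorem continuousOn_orbFamGExt_regG (hα : ∀ i, α i ≠ 0)
    {a' : ↥(arch (↥(maximalRealSubfield L)) L (IsCMField.complexConj L) 3 (Matrix.diagonal α)) → ℂ} (ha' : Continuous a') (ha'c : HasCompactSupport a') :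
    ContinuousOn (orbFamGExt L α ν' a' S') (RegG S') :=
  (continuousOn_orbFamG_regG L α ν' S' hα ha' ha'c).congr (orbFamGExt_eqOn_regG L α ν' a' S')

end FamilyC0

end Literature.NumberTheory.Rogawski1990

end
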